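import Mathlib
import Summits.MatrixMultiplication.MatrixMultiplication.Theses.SnSubsetDichotomy

/-!
# Boundary (load-bearing) analysis of the re-cut `X_band` of line `mover-covering-amgm` —
# crux `JuntaBranch` (stmt-MatrixMultiplication-8304)

The composition `JuntaBranch_of` of line `mover-covering-amgm`
(`Cruxes/JuntaBranch/Lines/mover_covering_amgm.lean`) consumes its structural stub
`stub_partnersDisjointOnBand` only through the AM–GM atom (`amgmAtom`): what the band pipeline needs
is an AM–GM-SCALE PARTNER ATOM at the target of `S`'s super-neutral band block,
`∃ J injective, |T|·(t/n)^t ≤ |T ∩ U_{J→L}|` (and the same for `U`), after which `windowGain`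
(proved in the workfile) and `UmvirateDescent` (tree theorem) give the crux's conclusion.  The line
card records this weaker statement ("X_band") as the re-cut of the skeleton should the disjointness
stub die.

This file proves that `X_band`, too, is inert without largeness: the statement
"TPP + partners inclusion-saturated w.r.t. `S` + `S` `ε`-super-neutral at a band block `(I→L)` of
size `1 ≤ t ≤ √n` ⇒ some source tuple `J` carries a `(t/n)^t` fraction of `T` at the target `L`"
is FALSE (`bandConcentration_false_without_large`).  Witness family: `n = m^8`, `ε = 1/4`, `c = 8`,
`t = 2m^3`, `S = Stab_pw(L)` (perfectly blocky), `T = Y` a full transversal of the atoms at `L`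
(one permutation `y_J` with `y_J ∘ J = L` for every injective `J`; `|Y| = n^{(t)}`, every atom
`Y ∩ U_{J→L}` is a singleton, and `Y` is AUTOMATICALLY inclusion-saturated w.r.t. `S`: an outsider
`g` shares its source tuple with some `y ∈ Y` and `g y⁻¹ ∈ Stab_pw(L) = Q(S)` breaks the TPP),
`U ⊇ {1}` saturated by finite maximality; then `|Y|(t/n)^t ≥ (2m^2)^t > 1 = max_J |Y_J|`.
So, exactly as for the disjointness stub (`Theorems/…PartnersDisjointBoundary.lean`), nothing but
`Large` can force partner concentration at `S`'s block: `X_band` is the crux's open core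
("BumpPropagation" restricted to the band) and carries no mechanism of its own.
-/

open Literature.Combinatorics.Additive
open scoped Classical

set_option linter.dupNamespace false

namespace Summit.MatrixMultiplication.MatrixMultiplication.Theorems.JuntaBranch

/-- **The band re-cut `X_band` is false without `Large`.**  Even with `1 ≤ t ≤ √n`, `t` in the band
`[2n^{(1-ε)/2}, c√n/(ε ln n + 2)]`, both partners inclusion-saturated w.r.t. `S` and `S`
`ε`-super-neutral at `(I → L)`, no source tuple need carry a `(t/n)^t` fraction of the middle
partner at the target `L` (`ε = 1/4`, `c = 8`, `n = m^8`, `t = 2m^3`, `S = Stab_pw(L)`, `T` = a full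
atom transversal, `U ⊇ {1}` saturated). [folklore] -/
theorem bandConcentration_false_without_large :
    ¬ (∀ ε : ℝ, 0 < ε → ∀ c : ℝ, 0 < c → ∃ n₀ : ℕ, ∀ n ≥ n₀,
      ∀ S T U : Finset (Equiv.Perm (Fin n)), TripleProductProperty S T U →
      (∀ g ∉ T, ¬ TripleProductProperty S (insert g T) U) →
      (∀ g ∉ U, ¬ TripleProductProperty S T (insert g U)) →
      ∀ t : ℕ, 1 ≤ t → (t : ℝ) ≤ Real.sqrt (n : ℝ) → 2 * (n : ℝ) ^ ((1 - ε) / 2) ≤ (t : ℝ) →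
      (t : ℝ) ≤ c * Real.sqrt (n : ℝ) / (ε * Real.log (n : ℝ) + 2) →
      ∀ I L : Fin t → Fin n, Function.Injective I → Function.Injective L →
      (n : ℝ) ^ ((1 / 2 + ε) * t) * (S.card : ℝ) <
        ((S.filter (fun σ => ∀ k, σ (I k) = L k)).card : ℝ) * (n.descFactorial t : ℝ) →
      ∃ J : Fin t → Fin n, Function.Injective J ∧
        (T.card : ℝ) * ((t : ℝ) / n) ^ t ≤ ((T.filter (fun σ => ∀ k, σ (J k) = L k)).card : ℝ)) := by
  intro h
  obtain ⟨n₀, hn₀⟩ := h (1 / 4) (by norm_num) 8 (by norm_num)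
  -- parameters: m ≥ max(n₀, 2), n = m^8, t = 2m^3
  obtain ⟨m, hm2, hmn₀⟩ : ∃ m : ℕ, 2 ≤ m ∧ n₀ ≤ m := ⟨max n₀ 2, le_max_right _ _, le_max_left _ _⟩
  obtain ⟨n, hn⟩ : ∃ n : ℕ, n = m ^ 8 := ⟨_, rfl⟩
  obtain ⟨t, ht⟩ : ∃ t : ℕ, t = 2 * m ^ 3 := ⟨_, rfl⟩
  have hm4 : 2 ≤ m ^ 4 := le_trans hm2 (Nat.le_self_pow (by norm_num) m)
  have h87 : 2 * m ^ 7 ≤ m ^ 8 := by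
    calc 2 * m ^ 7 ≤ m * m ^ 7 := Nat.mul_le_mul_right _ hm2
      _ = m ^ 8 := by ring
  have h73 : 2 * m ^ 3 ≤ m ^ 7 := by
    calc 2 * m ^ 3 ≤ m ^ 4 * m ^ 3 := Nat.mul_le_mul_right _ hm4
      _ = m ^ 7 := by ring
  have hn₀n : n₀ ≤ n := by
    rw [hn]
    exact hmn₀.trans (Nat.le_self_pow (by norm_num) m)
  have htn : t ≤ n := by rw [ht, hn]; omega
  have ht1 : 1 ≤ t := by
    rw [ht]
    have : 1 ≤ m ^ 3 := Nat.one_le_pow _ _ (by omega)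
    omega
  have hsub : m ^ 7 ≤ n + 1 - t := by rw [hn, ht]; omega
  -- real-number versions
  have hmR : (2 : ℝ) ≤ (m : ℝ) := by exact_mod_cast hm2
  have hm0 : (0 : ℝ) ≤ (m : ℝ) := by positivity
  have hmpos : (0 : ℝ) < (m : ℝ) := by positivity
  have hnR : (n : ℝ) = (m : ℝ) ^ 8 := by rw [hn]; push_cast; ring
  have htR : (t : ℝ) = 2 * (m : ℝ) ^ 3 := by rw [ht]; push_cast; ring
  have hsqrt : Real.sqrt (n : ℝ) = (m : ℝ) ^ 4 := by
    rw [hnR, show (m : ℝ) ^ 8 = ((m : ℝ) ^ 4) ^ 2 by ring, Real.sqrt_sq (by positivity)]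
  have hlog : Real.log (n : ℝ) = 8 * Real.log (m : ℝ) := by
    rw [hnR, Real.log_pow]; push_cast; ring
  have hlogm : Real.log (m : ℝ) ≤ (m : ℝ) - 1 := Real.log_le_sub_one_of_pos (by linarith)
  have hlogm0 : 0 ≤ Real.log (m : ℝ) := Real.log_nonneg (by linarith)
  -- the block L = the first t points, and S = its pointwise stabiliser
  set L : Fin t → Fin n := Fin.castLE htn with hLdef
  have hL : Function.Injective L := Fin.castLE_injective htn
  set S : Finset (Equiv.Perm (Fin n)) :=
    Finset.univ.filter (fun σ : Equiv.Perm (Fin n) => ∀ k, σ (L k) = L k) with hS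
  have hSfix : ∀ s ∈ S, ∀ k, s (L k) = L k := fun s hs => (Finset.mem_filter.1 hs).2
  have hSfix' : ∀ s ∈ S, ∀ k, s⁻¹ (L k) = L k := by
    intro s hs k
    rw [Equiv.Perm.inv_eq_iff_eq]
    exact (hSfix s hs k).symm
  -- the atom transversal Y = {y_J : J injective}, y_J ∘ J = L
  have hex : ∀ J : Fin t ↪ Fin n, ∃ y : Equiv.Perm (Fin n), ∀ k, y (J k) = L k :=
    fun J => Equiv.Perm.exists_extending_pair J L J.injective hL
  choose rep hrep using hex
  have hrep' : ∀ J : Fin t ↪ Fin n, ∀ k, (rep J)⁻¹ (L k) = J k := by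
    intro J k
    rw [Equiv.Perm.inv_eq_iff_eq]
    exact (hrep J k).symm
  -- `rep J` determines `J`
  have hrep_inj : ∀ J₁ J₂ : Fin t ↪ Fin n, (∀ k, rep J₁ (J₂ k) = L k) → J₁ = J₂ := by
    intro J₁ J₂ hk
    ext k
    have h1 : rep J₁ (J₁ k) = rep J₁ (J₂ k) := by rw [hrep J₁ k, hk k]
    exact congrArg Fin.val ((rep J₁).injective h1)
  set Y : Finset (Equiv.Perm (Fin n)) := Finset.univ.image rep with hY
  have hmemY : ∀ J, rep J ∈ Y := fun J => Finset.mem_image.2 ⟨J, Finset.mem_univ _, rfl⟩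
  -- |Y| = n^{(t)}
  have hYcard : Y.card = n.descFactorial t := by
    rw [hY, Finset.card_image_of_injective _ ?_]
    · simp [Fintype.card_embedding_eq]
    · intro J₁ J₂ h12
      apply hrep_inj
      intro k
      rw [h12]
      exact hrep J₂ k
  -- every atom of Y at the target L is a singleton (at most)
  have hYatom : ∀ J : Fin t → Fin n, Function.Injective J →
      (Y.filter (fun σ => ∀ k, σ (J k) = L k)).card ≤ 1 := by
    intro J hJ
    refine Finset.card_le_one.2 ?_
    intro y₁ hy₁ y₂ hy₂
    simp only [Finset.mem_filter, hY, Finset.mem_image, Finset.mem_univ, true_and] at hy₁ hy₂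
    obtain ⟨⟨J₁, rfl⟩, h₁⟩ := hy₁
    obtain ⟨⟨J₂, rfl⟩, h₂⟩ := hy₂
    have e₁ : J₁ = ⟨J, hJ⟩ := hrep_inj J₁ ⟨J, hJ⟩ h₁
    have e₂ : J₂ = ⟨J, hJ⟩ := hrep_inj J₂ ⟨J, hJ⟩ h₂
    rw [e₁, e₂]
  -- TPP of (S, Y, {1})
  have hTPP₀ : TripleProductProperty S Y ({1} : Finset (Equiv.Perm (Fin n))) := by
    intro s hs s' hs' y hy y' hy' u hu u' hu' hrel
    simp only [Finset.mem_singleton] at hu hu'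
    subst hu
    subst hu'
    have hq : s * s'⁻¹ * (y * y'⁻¹) = 1 := by simpa using hrel
    rw [hY, Finset.mem_image] at hy hy'
    obtain ⟨J₁, -, rfl⟩ := hy
    obtain ⟨J₂, -, rfl⟩ := hy'
    have hyy : rep J₁ * (rep J₂)⁻¹ = (s * s'⁻¹)⁻¹ := eq_inv_of_mul_eq_one_right hq
    have e12 : J₁ = J₂ := by
      apply hrep_inj
      intro k
      have h1 : (rep J₁ * (rep J₂)⁻¹) (L k) = L k := by
        rw [hyy, mul_inv_rev, inv_inv, Equiv.Perm.mul_apply, hSfix' s hs k, hSfix s' hs' k]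
      rw [Equiv.Perm.mul_apply, hrep' J₂ k] at h1
      exact h1
    subst e12
    refine ⟨?_, rfl, rfl⟩
    have h1 : s * s'⁻¹ = 1 := by simpa using hq
    exact mul_inv_eq_one.mp h1
  -- saturate the right partner (finite maximality); Y is automatically saturated
  obtain ⟨U', hUU', hU'max⟩ :=
    Finite.exists_le_maximal (p := fun U' : Finset (Equiv.Perm (Fin n)) =>
      TripleProductProperty S Y U') hTPP₀
  have h1U : (1 : Equiv.Perm (Fin n)) ∈ U' := hUU' (Finset.mem_singleton_self _)
  have hsatR : ∀ g ∉ U', ¬ TripleProductProperty S Y (insert g U') := by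
    intro g hg hins
    have h2 : insert g U' ≤ U' := hU'max.2 hins (Finset.subset_insert g U')
    exact hg (h2 (Finset.mem_insert_self g U'))
  have hsatM : ∀ g ∉ Y, ¬ TripleProductProperty S (insert g Y) U' := by
    intro g hg hins
    -- the source tuple of g and its representative y ∈ Y; q := g y⁻¹ ∈ Stab_pw(L) = S
    set Jg : Fin t ↪ Fin n := ⟨fun k => g⁻¹ (L k), g⁻¹.injective.comp hL⟩ with hJg
    set y : Equiv.Perm (Fin n) := rep Jg with hydef
    have hyY : y ∈ Y := hmemY Jg
    have hq : g * y⁻¹ ∈ S := by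
      rw [hS, Finset.mem_filter]
      refine ⟨Finset.mem_univ _, fun k => ?_⟩
      rw [Equiv.Perm.mul_apply, hydef, hrep' Jg k]
      simp [hJg]
    have h1S : (1 : Equiv.Perm (Fin n)) ∈ S := by simp [hS]
    have key := hins (g * y⁻¹) hq 1 h1S y (Finset.mem_insert_of_mem hyY) g
      (Finset.mem_insert_self g Y) 1 h1U 1 h1U (by group)
    exact hg (key.2.1 ▸ hyY)
  -- band membership of t and t ≤ √n
  have hlo : 2 * (n : ℝ) ^ (((1 : ℝ) - 1 / 4) / 2) ≤ (t : ℝ) := by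
    rw [hnR, htR, show ((1 : ℝ) - 1 / 4) / 2 = 3 / 8 by norm_num,
      show ((m : ℝ) ^ 8) = (m : ℝ) ^ ((8 : ℕ) : ℝ) by rw [Real.rpow_natCast],
      ← Real.rpow_mul hm0, show ((8 : ℕ) : ℝ) * (3 / 8) = ((3 : ℕ) : ℝ) by norm_num,
      Real.rpow_natCast]
  have hhi : (t : ℝ) ≤ 8 * Real.sqrt (n : ℝ) / (1 / 4 * Real.log (n : ℝ) + 2) := by
    rw [hsqrt, hlog, htR, le_div_iff₀ (by nlinarith)]
    have h3 : (0 : ℝ) ≤ (m : ℝ) ^ 3 := by positivity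
    nlinarith [mul_le_mul_of_nonneg_left hlogm h3]
  have htsqrt : (t : ℝ) ≤ Real.sqrt (n : ℝ) := by
    rw [hsqrt, htR]
    nlinarith [pow_le_pow_left₀ (by norm_num : (0 : ℝ) ≤ 2) hmR 3, sq_nonneg ((m : ℝ))]
  -- super-neutrality of S at (L → L)
  have hSfilter : S.filter (fun σ => ∀ k, σ (L k) = L k) = S := by
    ext σ
    simp [hS]
  have hScard : (0 : ℝ) < (S.card : ℝ) := by
    have h1 : (1 : Equiv.Perm (Fin n)) ∈ S := by simp [hS]
    exact_mod_cast Finset.card_pos.mpr ⟨1, h1⟩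
  have hdesc : (m : ℝ) ^ (7 * t) ≤ (n.descFactorial t : ℝ) := by
    have h1 : (n + 1 - t) ^ t ≤ n.descFactorial t := Nat.pow_sub_le_descFactorial n t
    have h2 : (m ^ 7) ^ t ≤ (n + 1 - t) ^ t := Nat.pow_le_pow_left hsub t
    have h3 : ((m ^ 7) ^ t : ℕ) ≤ n.descFactorial t := h2.trans h1
    have h4 : (((m ^ 7) ^ t : ℕ) : ℝ) ≤ (n.descFactorial t : ℝ) := by exact_mod_cast h3
    rw [← pow_mul] at h4
    push_cast at h4
    exact h4
  have hpow : (n : ℝ) ^ ((1 / 2 + 1 / 4) * (t : ℝ)) = (m : ℝ) ^ (6 * t) := by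
    rw [hnR, show ((m : ℝ) ^ 8) = (m : ℝ) ^ ((8 : ℕ) : ℝ) by rw [Real.rpow_natCast],
      ← Real.rpow_mul hm0,
      show ((8 : ℕ) : ℝ) * ((1 / 2 + 1 / 4) * (t : ℝ)) = ((6 * t : ℕ) : ℝ) by push_cast; ring,
      Real.rpow_natCast]
  have hlt : (m : ℝ) ^ (6 * t) < (m : ℝ) ^ (7 * t) :=
    pow_lt_pow_right₀ (by linarith) (by omega)
  have hSN : (n : ℝ) ^ ((1 / 2 + 1 / 4) * (t : ℝ)) * (S.card : ℝ) <
      ((S.filter (fun σ => ∀ k, σ (L k) = L k)).card : ℝ) * (n.descFactorial t : ℝ) := by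
    rw [hSfilter, hpow, mul_comm]
    exact mul_lt_mul_of_pos_left (hlt.trans_le hdesc) hScard
  -- apply the statement: some atom of Y carries a (t/n)^t fraction of Y — but atoms are singletons
  obtain ⟨J, hJ, hle⟩ :=
    hn₀ n hn₀n S Y U' hU'max.1 hsatM hsatR t ht1 htsqrt hlo hhi L L hL hL hSN
  have hone : ((Y.filter (fun σ => ∀ k, σ (J k) = L k)).card : ℝ) ≤ 1 := by
    exact_mod_cast hYatom J hJ
  have hbig : (1 : ℝ) < (Y.card : ℝ) * ((t : ℝ) / n) ^ t := by
    rw [hYcard, hnR, htR]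
    have hq : 2 * (m : ℝ) ^ 3 / (m : ℝ) ^ 8 = 2 / (m : ℝ) ^ 5 := by
      field_simp
    rw [hq]
    have hm5 : (0 : ℝ) < (m : ℝ) ^ 5 := by positivity
    have h1 : (2 * (m : ℝ) ^ 2) ^ t ≤ (n.descFactorial t : ℝ) * (2 / (m : ℝ) ^ 5) ^ t := by
      calc (2 * (m : ℝ) ^ 2) ^ t = ((m : ℝ) ^ 7 * (2 / (m : ℝ) ^ 5)) ^ t := by
            congr 1
            field_simp
        _ = (m : ℝ) ^ (7 * t) * (2 / (m : ℝ) ^ 5) ^ t := by rw [mul_pow, ← pow_mul]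
        _ ≤ (n.descFactorial t : ℝ) * (2 / (m : ℝ) ^ 5) ^ t :=
            mul_le_mul_of_nonneg_right hdesc (by positivity)
    have h2 : (1 : ℝ) < (2 * (m : ℝ) ^ 2) ^ t := one_lt_pow₀ (by nlinarith) (by omega)
    exact h2.trans_le h1
  linarith

end Summit.MatrixMultiplication.MatrixMultiplication.Theorems.JuntaBranch
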